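/-
Origin: expansion seat `planner-pub-hodgecm-toy-0`, handover #2 2026-08-18T04:13:45Z (`HOME/pub-hodgecm-toy/lean/Toy/Axioms.lean`, md5 dade86a8, 166 lines);
landed by the gen-5 packager in gate run 21 as `HodgeCM/Model/Toy/Axioms.lean` (import ^import Toy\.→import HodgeCM.Model.Toy. ×1).
-/
-- HANDOVER (planner-pub-hodgecm-toy-0, unit pub-hodgecm-toy): WIP module `Toy.Axioms`; intended final module
-- `HodgeCM.Model.Toy.Axioms` (kind L5, toy model / consistency witness); rename `import Toy.X` ↦ the final prefix.
/-
Copyright: pub-hodgecm cell (HodgeCMPerL). Consistency-witness layer (part (e), referee A G4).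

# The structural model axioms hold in `toyModelWith D`

All fields of `ModelAxioms` that are properties of the exterior-algebra / product / trace structure
(M1–M10, M14 `cmAV`, M18–M24, M26, M27, `pms_dim`) are discharged here for an ARBITRARY `HodgeData`.
The CM-specific fields (eigenlines, Weil line, conjugate isogeny, CM domination) are in
`HodgeCM.Toy.CMFacts` and `HodgeCM.Toy.Weil`.
-/
import Mathlib
import Summits.HodgeConjecture.HodgeCM.Model.Toy.Model

namespace HodgeCM.Toy

open Literature.AlgebraicGeometry.Motives
open Literature.AlgebraicGeometry.Motives.HodgeStructure (EndAction conj ofRat mem_hodgeClasses_iff)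
open scoped TensorProduct
open exteriorPower CMPresentation

noncomputable section

variable (D : HodgeData)

/-! ### Unfolding lemmas (all `rfl`) -/
section unfold
variable {D}
variable {X Y Z : Obj}

/-- (Ported verbatim from the HodgeCMPerL package; no docstring in the source.) -/
lemma Var_eq : (toyModelWith D).Var = Obj := rfl
/-- (Ported verbatim from the HodgeCMPerL package; no docstring in the source.) -/
lemma pull_eq (f : Obj.Hom X Y) (k : ℕ) : (toyModelWith D).pull (X := X) (Y := Y) f k = map k f.lin := rfl
/-- (Ported verbatim from the HodgeCMPerL package; no docstring in the source.) -/
lemma comp_eq (f : Obj.Hom X Y) (g : Obj.Hom Y Z) :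
    (toyModelWith D).comp (X := X) (Y := Y) (Z := Z) f g = f.comp g := rfl
/-- (Ported verbatim from the HodgeCMPerL package; no docstring in the source.) -/
lemma cup_eq (X : Obj) (i j : ℕ) : (toyModelWith D).cup X i j = wedge ℚ X.L i j := rfl
/-- (Ported verbatim from the HodgeCMPerL package; no docstring in the source.) -/
lemma tr_eq (X : Obj) (k : ℕ) : (toyModelWith D).tr X k = 0 := rfl
/-- (Ported verbatim from the HodgeCMPerL package; no docstring in the source.) -/
lemma alg_eq (X : Obj) (p : ℕ) : (toyModelWith D).alg X p = (D.hs X (2 * p)).hodgeClasses (p : ℤ) := rfl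
/-- (Ported verbatim from the HodgeCMPerL package; no docstring in the source.) -/
lemma hodgeClassesOf_eq (X : Obj) (p : ℕ) :
    (toyModelWith D).hodgeClassesOf X p = (D.hs X (2 * p)).hodgeClasses (p : ℤ) := rfl
/-- (Ported verbatim from the HodgeCMPerL package; no docstring in the source.) -/
lemma dim_eq (X : Obj) : (toyModelWith D).dim X = Module.finrank ℚ X.L / 2 + X.extra := rfl
/-- (Ported verbatim from the HodgeCMPerL package; no docstring in the source.) -/
lemma cmAV_eq (K : CMField) (Φ : CMType K) : (toyModelWith D).cmAV K Φ = cmObj K Φ := rfl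
/-- (Ported verbatim from the HodgeCMPerL package; no docstring in the source.) -/
lemma cmAct_ι_eq (K : CMField) (Φ : CMType K) (e : K) :
    ((toyModelWith D).cmAct K Φ).ι e = map 1 (mulK K Φ e) := cmι_apply K Φ e
/-- (Ported verbatim from the HodgeCMPerL package; no docstring in the source.) -/
lemma ofRat_eq {V : Type*} [AddCommGroup V] [Module ℚ V] (v : V) : ofRat v = (1 : ℂ) ⊗ₜ[ℚ] v := rfl

end unfold

/-! ### Dimension counts -/

/-- (Ported verbatim from the HodgeCMPerL package; no docstring in the source.) -/
lemma finrank_L_cmObj (K : CMField) (Φ : CMType K) :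
    Module.finrank ℚ (cmObj K Φ).L = Module.finrank ℚ K := by
  rw [Module.finrank_pi_fintype]
  simp [finrank_FK]

/-- (Ported verbatim from the HodgeCMPerL package; no docstring in the source.) -/
lemma finrank_L_pmsObj : Module.finrank ℚ pmsObj.L = 0 := Module.finrank_zero_of_subsingleton

/-! ### M1–M10 -/

/-- (Ported verbatim from the HodgeCMPerL package; no docstring in the source.) -/
theorem fact_pull_id : (toyModelWith D).Fact_pull_id := fun _ _ => map_id

/-- (Ported verbatim from the HodgeCMPerL package; no docstring in the source.) -/
theorem fact_pull_comp : (toyModelWith D).Fact_pull_comp := fun _ _ _ _ _ _ => map_comp _ _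

/-- (Ported verbatim from the HodgeCMPerL package; no docstring in the source.) -/
theorem fact_pull_cup : (toyModelWith D).Fact_pull_cup := fun _ _ f i j x y => map_wedge i j f.lin x y

/-- (Ported verbatim from the HodgeCMPerL package; no docstring in the source.) -/
theorem fact_pull_hodge : (toyModelWith D).Fact_pull_hodge := fun _ _ f k p => D.natural f k p

/-- (Ported verbatim from the HodgeCMPerL package; no docstring in the source.) -/
theorem fact_cup2_hodge : (toyModelWith D).Fact_cup2_hodge := fun X k p q x y hx hy => D.mul X k p q x y hx hy

/-- (Ported verbatim from the HodgeCMPerL package; no docstring in the source.) -/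
theorem fact_tr_degree : (toyModelWith D).Fact_tr_degree := fun _ _ _ => rfl

/-- (Ported verbatim from the HodgeCMPerL package; no docstring in the source.) -/
theorem fact_alg_le_hodge : (toyModelWith D).Fact_alg_le_hodge := fun _ _ => le_rfl

/-- (Ported verbatim from the HodgeCMPerL package; no docstring in the source.) -/
theorem fact_lefschetz11 : (toyModelWith D).Fact_Lefschetz11 := fun _ => le_rfl

/-- (Ported verbatim from the HodgeCMPerL package; no docstring in the source.) -/
theorem fact_pull_alg : (toyModelWith D).Fact_pull_alg := by
  intro X Y f p v hv
  obtain ⟨w, hw, rfl⟩ := Submodule.mem_map.mp hv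
  change w ∈ (D.hs Y (2 * p)).hodgeClasses (p : ℤ) at hw
  change map (2 * p) f.lin w ∈ (D.hs X (2 * p)).hodgeClasses (p : ℤ)
  rw [mem_hodgeClasses_iff] at hw ⊢
  refine D.natural f (2 * p) p ⟨ofRat w, hw, ?_⟩
  simp [LinearMap.baseChange_tmul]

/-- (Ported verbatim from the HodgeCMPerL package; no docstring in the source.) -/
theorem fact_cup_alg : (toyModelWith D).Fact_cup_alg := by
  intro X x y hx hy
  change x ∈ (D.hs X (2 * 1)).hodgeClasses ((1 : ℕ) : ℤ) at hx
  change y ∈ (D.hs X (2 * 1)).hodgeClasses ((1 : ℕ) : ℤ) at hy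
  change wedge ℚ X.L 2 2 x y ∈ (D.hs X (2 * 2)).hodgeClasses ((2 : ℕ) : ℤ)
  rw [mem_hodgeClasses_iff] at hx hy ⊢
  have h := D.mul X 2 1 1 (ofRat x) (ofRat y) hx hy
  have e : LinearMap.BilinMap.baseChange ℂ (wedge ℚ X.L 2 2) (ofRat x) (ofRat y) = ofRat (wedge ℚ X.L 2 2 x y) := by
    simp [LinearMap.BilinMap.baseChange_tmul]
  rw [e] at h
  simpa using h

/-! ### M14 and the surface dimension -/

/-- (Ported verbatim from the HodgeCMPerL package; no docstring in the source.) -/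
theorem fact_cmAV : (toyModelWith D).Fact_cmAV := by
  intro K Φ
  refine ⟨rfl, ⟨K, Φ, rfl⟩, ?_⟩
  change Module.finrank ℚ (cmObj K Φ).L / 2 + 0 = K.halfDegree
  rw [finrank_L_cmObj, add_zero]
  rfl

/-- (Ported verbatim from the HodgeCMPerL package; no docstring in the source.) -/
theorem fact_pms_dim : (toyModelWith D).PmsDimTwo := by
  intro L ι₁ V Γ
  change Module.finrank ℚ pmsObj.L / 2 + 2 = 2
  rw [finrank_L_pmsObj]

/-! ### M18–M23 -/

/-- (Ported verbatim from the HodgeCMPerL package; no docstring in the source.) -/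
theorem fact_lift : (toyModelWith D).Fact_lift := fun _ _ _ f g =>
  ⟨Obj.lift f g, Obj.lift_comp_fst f g, Obj.lift_comp_snd f g⟩

/-- (Ported verbatim from the HodgeCMPerL package; no docstring in the source.) -/
theorem fact_cup_comm1 : (toyModelWith D).Fact_cup_comm1 := fun _ a b => wedge_comm_one a b

/-- (Ported verbatim from the HodgeCMPerL package; no docstring in the source.) -/
theorem fact_cup_interchange : (toyModelWith D).Fact_cup_interchange := fun _ a b c d =>
  wedge_interchange a b c d

/-- The Künneth map in degree one is the composite of three linear equivalences. -/
def kunnethEquiv (X Y : Obj) : (↥(⋀[ℚ]^1 X.L) × ↥(⋀[ℚ]^1 Y.L)) ≃ₗ[ℚ] ↥(⋀[ℚ]^1 (X.prod Y).L) :=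
  ((oneEquiv ℚ X.L).prodCongr (oneEquiv ℚ Y.L)).trans
    ((X.sumEquiv Y).symm.trans (oneEquiv ℚ (X.prod Y).L).symm)

/-- (Ported verbatim from the HodgeCMPerL package; no docstring in the source.) -/
lemma inlL_add_inrL (X Y : Obj) (x : X.L) (y : Y.L) :
    X.inlL Y x + X.inrL Y y = (X.sumEquiv Y).symm (x, y) := by
  simp only [Obj.inlL, Obj.inrL, LinearMap.coe_comp, LinearEquiv.coe_coe, Function.comp_apply,
    LinearMap.inl_apply, LinearMap.inr_apply, ← map_add, Prod.mk_add_mk, add_zero, zero_add]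

/-- (Ported verbatim from the HodgeCMPerL package; no docstring in the source.) -/
lemma kunneth_eq (X Y : Obj) :
    ((toyModelWith D).pull ((toyModelWith D).fst X Y) 1).coprod ((toyModelWith D).pull ((toyModelWith D).snd X Y) 1)
      = (kunnethEquiv X Y).toLinearMap := by
  apply LinearMap.ext
  rintro ⟨a, b⟩
  change map 1 (X.inlL Y) a + map 1 (X.inrL Y) b = _
  simp only [map_one_eq, LinearMap.coe_comp, LinearEquiv.coe_coe, Function.comp_apply, kunnethEquiv,
    LinearEquiv.trans_apply, LinearEquiv.prodCongr_apply, ← map_add, inlL_add_inrL]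

/-- (Ported verbatim from the HodgeCMPerL package; no docstring in the source.) -/
theorem fact_kunneth1 : (toyModelWith D).Fact_kunneth1 := by
  intro X Y
  rw [kunneth_eq]
  exact (kunnethEquiv X Y).bijective

/-- (Ported verbatim from the HodgeCMPerL package; no docstring in the source.) -/
theorem fact_H1_rank : (toyModelWith D).Fact_H1_rank := by
  intro K Φ
  change Module.finrank ℚ ↥(⋀[ℚ]^1 (cmObj K Φ).L) = _
  rw [(oneEquiv ℚ (cmObj K Φ).L).finrank_eq, finrank_L_cmObj]

/-- (Ported verbatim from the HodgeCMPerL package; no docstring in the source.) -/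
theorem fact_H4_span : (toyModelWith D).Fact_H4_span := fun _ _ => span_wedge4_eq_top

/-! ### M24, M26, M27 -/

/-- (Ported verbatim from the HodgeCMPerL package; no docstring in the source.) -/
theorem fact_cmEnd : (toyModelWith D).Fact_cmEnd := fun K Φ a =>
  ⟨mulHom K Φ (a : K), (cmι_apply K Φ (a : K)).symm⟩

/-- (Ported verbatim from the HodgeCMPerL package; no docstring in the source.) -/
theorem fact_gysin_surface : (toyModelWith D).Fact_gysin_surface := fun _ _ _ _ =>
  ⟨0, Submodule.zero_mem _, fun _ => rfl⟩

/-- (Ported verbatim from the HodgeCMPerL package; no docstring in the source.) -/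
theorem fact_deg_diag : (toyModelWith D).Fact_deg_diag := by
  intro K Φ a M _ k
  rw [tr_eq, LinearMap.zero_comp, smul_zero]

end

end HodgeCM.Toy
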